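import Summits.QuantumFields.YangMills.Theorems.AlphaInputsT3ACv3LinearLiftBiorth
import HarnessLib

/-!
# `AlphaInputsT3ACv3LinearLiftTorus` — (LL) STEP L4: ★★★ THE EXACT LINEAR LIFT ON THE WHOLE TORUS — every coarse one-form `A` on `T^{(k)}` is the EXACT `k`-fold (0.4)-linear
# average of a finest one-form whose lattice curls are the spread of the coarse curls: `|curl a| ≤ 18^d · sup|curl A| / L^{2k}` — cell `ym3-torus`, width seat `ym-ust-19936-w2` (g0)

WHAT.  `lift k A := S1 k A − dgrad (x ↦ −Ψ_k(S1 k A)(coarsen_k x))` (the spread of `A` corrected by the pure gauge that absorbs the (0.4) coboundary):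
* §1 `linAvgIter_sub`, `iterBlockOf_toFine`, `dgrad_neg'`, `curlAt_sub`, `curlAt_dgrad` (the curl of a gradient vanishes: `shift_shift_comm`).
* §2 ★★ `linAvgIter_lift : linAvgIter k (lift k A) = A` (`linAvgIter_eq_segIter_sub` + `segIter_S1` + `linAvgIter_dgrad`); ★★ `curlAt_lift : curlAt (lift k A) x μ ν = S2 k (curlAt A) x μ ν`;
  ★★★ `exists_linearLift_torus`: for every coarse `A` with `|curlAt A y μ ν| ≤ ε` (all `y`, `μ ≠ ν`) there is a finest `a` with `linAvgIter k a = A` and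
  `|curlAt a x μ ν| ≤ 18^d · ε / (L^k)²` — (LL) of HOME `pub-balaban3d/D6R-SEAMS-alpha2-g4.md` §7 ON THE FULL TORUS (`Ω = T`), with the ABSOLUTE constant `B_lin = 18^d`
  (= 5832 at `d = 3`; no dependence on `L`, `k`, the volume).  The REGION version (curl hypothesis only on `plaqsIn k Ω`, conclusion on `plaqsIn 0 Ω` and `bondsIn k Ω`, for
  Bałaban's big-block regions `Ω_k(h)`) is the remaining file L5 of the plan (HOME `ym3-torus/ym-ust-19936-w2/LL-PLAN-w2-g0.md`).
HONEST FRAMING.  A theorem of finite-dimensional linear algebra on the lattice tori of [Balaban1987RG1] (0.1)–(0.4); it does NOT yet discharge (FL) (the regional statement is what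
p581514 `fineLift_of_linearLift_abelian` consumes); nothing of [Balaban1985UV3]∕[Balaban1985Variational] is asserted; count-neutral helper toward the (FL) row of 2′∕2′χ
(`--supports stmt-QuantumFields-19936`); registry untouched.  YM₃ on the torus is a RUNG of the programme, not the Clay problem; no claim about d = 4, infinite volume or a mass gap.

References: T. Bałaban, Commun. Math. Phys. 109 (1987) 249–301 [Balaban1987RG1] ((0.1) p.251, (0.4)+(0.11) p.253); Commun. Math. Phys. 102 (1985) 277–309 [Balaban1985Variational]
(Thm 1 (8) p.279: the `L^{−2k}` regularity window the lift realises).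
-/

set_option autoImplicit false

noncomputable section

namespace Summit.QuantumFields.YangMills.Theorems.LinearLiftSpread

open Finset
open Literature.MathematicalPhysics.QuantumFieldTheory.Balaban1983to89
open Literature.MathematicalPhysics.QuantumFieldTheory.Balaban1983to89.BlockAveragingEMLProp2 (shift_shift_comm)
open Literature.MathematicalPhysics.QuantumFieldTheory.Balaban1983to89.B5Eq118OneStroke (iterBlockOf iterBlockOf_zero iterBlockOf_succ)
open Literature.MathematicalPhysics.QuantumFieldTheory.Balaban1983to89.B10Eq38TorusDomains (toFine toFine_zero toFine_succ)
open Summit.QuantumFields.YangMills.Theorems.AbelianEML (linAvgIter linAvg04 linAvgIter_succ curlAt)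
open Summit.QuantumFields.YangMills.Theorems.LinearLiftGauge (dgrad segIter psiIter linAvgIter_eq_segIter_sub linAvgIter_dgrad linAvg04_sub)

variable {P : Params}

/-! ## §1 Bookkeeping -/

/-- `linAvgIter` is linear: subtraction. [cite: Balaban1987RG1, (0.11) p.253] -/
theorem linAvgIter_sub (a b : PBond P 0 → ℝ) : ∀ s : ℕ, linAvgIter s (a - b) = linAvgIter s a - linAvgIter s b
  | 0 => rfl
  | s + 1 => by rw [linAvgIter_succ, linAvgIter_succ, linAvgIter_succ, linAvgIter_sub a b s, linAvg04_sub]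

/-- The `k`-fold block point of a `k`-fold centre is the coarse site: `coarsen_k (toFine k y) = y` (standing range). [cite: Balaban1987RG1, (0.1) p.252] -/
theorem iterBlockOf_toFine : ∀ (k : ℕ), k ≤ P.m + P.K → ∀ y : Site P k, iterBlockOf k (toFine k y) = y
  | 0, _, _ => rfl
  | k + 1, hk, y => by
    rw [toFine_succ, iterBlockOf_succ, iterBlockOf_toFine k (by omega) (emb y), Site.blockOf_emb hk]

variable {j : ℕ}

/-- `d(−g) = −dg`. [folklore] -/
theorem dgrad_neg' (g : Site P j → ℝ) : dgrad (fun y => -g y) = fun b => -dgrad g b := by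
  funext b; simp only [dgrad]; ring

/-- The lattice curl is linear: subtraction. [folklore] -/
theorem curlAt_sub (a b : PBond P j → ℝ) (x : Site P j) (μ ν : Fin P.d) : curlAt (a - b) x μ ν = curlAt a x μ ν - curlAt b x μ ν := by
  simp only [curlAt, Pi.sub_apply]; ring

/-- **THE CURL OF A GRADIENT VANISHES** (`(x + e_μ) + e_ν = (x + e_ν) + e_μ`). [folklore] -/
theorem curlAt_dgrad (g : Site P j → ℝ) (x : Site P j) (μ ν : Fin P.d) : curlAt (dgrad g) x μ ν = 0 := by
  simp only [curlAt, dgrad, PBond.tgt]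
  rw [shift_shift_comm x μ ν]
  ring

/-! ## §2 The lift -/

/-- **THE EXACT LINEAR LIFT** of a coarse one-form `A` on `T^{(k)}` to the finest torus: the spread `S1 k A` corrected by the pure gauge `d(Ψ_k(S1 k A) ∘ coarsen_k)` that absorbs
the (0.4) coboundary. [cite: Balaban1987RG1, (0.4)+(0.11) p.253] -/
def lift (k : ℕ) (A : PBond P k → ℝ) : PBond P 0 → ℝ :=
  S1 k A - dgrad (fun x => -psiIter k (S1 k A) (iterBlockOf k x))

variable (k : ℕ) (hk : k ≤ P.m + P.K)
include hk

/-- **★★ EXACTNESS**: `linAvgIter k (lift k A) = A` — the `k`-fold (0.4)-linear average of the lift IS the coarse one-form. [cite: Balaban1987RG1, (0.4)+(0.11) p.253] -/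
theorem linAvgIter_lift (A : PBond P k → ℝ) : linAvgIter k (lift k A) = A := by
  unfold lift
  rw [linAvgIter_sub, linAvgIter_eq_segIter_sub, segIter_S1 k hk, linAvgIter_dgrad]
  have e : ((fun x : Site P 0 => -psiIter k (S1 k A) (iterBlockOf k x)) ∘ toFine k) = fun y => -psiIter k (S1 k A) y := by
    funext y; simp only [Function.comp, iterBlockOf_toFine k hk y]
  rw [e, dgrad_neg']
  funext b
  simp only [Pi.sub_apply]
  ring

/-- **★★ THE CURL OF THE LIFT IS THE SPREAD OF THE COARSE CURL**: `curlAt (lift k A) x μ ν = S2 k (curlAt A) x μ ν` (`μ ≠ ν`). [cite: Balaban1987RG1, (0.4) p.253] -/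
theorem curlAt_lift (A : PBond P k → ℝ) (x : Site P 0) {μ ν : Fin P.d} (hμν : μ ≠ ν) :
    curlAt (lift k A) x μ ν = S2 k (fun y μ' ν' => curlAt A y μ' ν') x μ ν := by
  unfold lift
  rw [curlAt_sub, curlAt_dgrad, sub_zero, curlAt_S1 k hk A x hμν]

/-- **★★★ (LL) ON THE FULL TORUS WITH AN ABSOLUTE CONSTANT**: every coarse one-form `A` on `T^{(k)}` whose lattice curls are bounded by `ε` is the EXACT `k`-fold (0.4)-linear average
of a finest one-form whose lattice curls are bounded by `18^d · ε / (L^k)²`. [cite: Balaban1987RG1, (0.4)+(0.11) p.253; Balaban1985Variational, Thm 1 (8) p.279] -/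
theorem exists_linearLift_torus (A : PBond P k → ℝ) {ε : ℝ} (hA : ∀ (y : Site P k) (μ ν : Fin P.d), μ ≠ ν → |curlAt A y μ ν| ≤ ε) :
    ∃ a : PBond P 0 → ℝ, linAvgIter k a = A ∧
      ∀ (x : Site P 0) (μ ν : Fin P.d), μ ≠ ν → |curlAt a x μ ν| ≤ (18 : ℝ) ^ P.d * ε / ((P.L : ℝ) ^ k) ^ 2 := by
  refine ⟨lift k A, linAvgIter_lift k hk A, fun x μ ν hμν => ?_⟩
  rw [curlAt_lift k hk A x hμν]
  exact abs_S2_le k (fun y μ' ν' => curlAt A y μ' ν') x hμν fun y => hA y μ ν hμν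

end Summit.QuantumFields.YangMills.Theorems.LinearLiftSpread

end
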